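/-
Copyright (c) 2026. All rights reserved.
Released under Apache 2.0 license as described in the file LICENSE.
Authors: abc-iut cell, F fact-proving wave seat abc-iut-f-073 (tranche 73, exact criterion for F-0319).
-/
import Literature.AnabelianGeometry.AbsoluteAnabelian.AbsTopIII.BiAnabelianIncompatibilityKernelCells

/-!
# [AbsTopIII] Cor 3.7 (iv), first incompatibility — SUFFICIENCY of the kernel statement: from a
# natural `ζ : 𝟭 ⥲ log` with `λ^×(ζ) ≫ ι_log = ι_×`, ONE family of homotopies on `𝒟†_{≤3}` containing
# a core structure on `𝒟†_{≤1}` AND the pinned homotopies of `𝔖†_log`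

S. Mochizuki, *Topics in absolute anabelian geometry III* [MochizukiAbsTopIII2015] (kurims manuscript
`paper:url-5493eb38cbb7`; journal pagination not held), Cor 3.7 (iii)/(iv) p. 88, Def 3.5 (ii) p. 75.

Step 3 (last) of the second half of the EXACT CRITERION for the schema row F-0319 `IncompatibleStmt`
(abc-iut-L4-t9's `BiAnabelianIncompatibility.lean`): `IncompatibleStmt 𝔖 ↔ ¬ LogCoreKernel 𝔖`
(first half `incompatibleStmt_of_not_logCoreKernel`: `BiAnabelianIncompatibilityKernelNecessity.lean`;
the `iff` is assembled in `BiAnabelianIncompatibilityCriterion.lean`).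

* `kerFamily ζ` — abc-iut-f-074's `laxFamily` of the coherent system `kerCells ζ` on the shadow
  `kerShadow ζ`: a family of homotopies (Def 3.5 (ii)) on `𝒟†_{≤3}`, for EVERY `ζ : 𝟭 ≅ log`;
* `kerFamily_core` — it contains an ISOMORPHISM for every would-be core pair
  `([pr_{⋎+1}], [pr_⋎]∘[log_𝒳])` (the lax universal homotopy over an identity 2-cell — `ζ` whiskered
  by `pr_{⋎+1}` up to the structure isomorphisms; `luniv_isIso`);
* `kerFamily_η_times`, `kerFamily_η_log` — it contains the type-(2) pair `([λ^×],[λ^{×pf}])` with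
  homotopy `ι_×` and the type-(1) pairs with homotopy `λ^×(ζ⁻¹) ≫ ι_×`, which IS `ι_{log,⋎}` as soon
  as `ζ` satisfies the kernel equation `λ^×(ζ_A) ≫ ι_{log,A} = ι_{×,A}`; so `kerFamily_logPinned`;
* **`not_incompatibleStmt_of_logCoreKernel : 𝔖.LogCoreKernel → ¬ 𝔖.IncompatibleStmt`** — a setting
  with the kernel statement (F-0388) DOES admit a structure of core on `𝒟†_{≤1}` compatible with
  `𝔖†_log`, in the typed sense.

HONEST FRAMING: a construction over the cell's typing of refereed pre-IUT material with ABSTRACT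
input data (`BiAnabelianSetting`); for the MLF data `LogCoreKernel` FAILS (Lemma 3.4,
`TFModel.modelSetting_not_logCoreKernel`) and Cor 3.7 (iv) holds (`TFModel.model_incompatibleStmt`);
nothing here bears on [IUTchIII] Cor. 3.12 or takes a side; typed ≠ proved.
-/

set_option autoImplicit false

namespace Literature.AnabelianGeometry.AbsoluteAnabelian.AbsTopIII

open CategoryTheory Quiver DiagramOfCategories

universe u

namespace BiAnabelianSetting

variable {X E N : Type u} [Category.{u} X] [Category.{u} E] [Category.{u} N]
  (𝔖 : BiAnabelianSetting X E N)

/-! ## The family of homotopies `kerFamily ζ` on `𝒟†_{≤3}` -/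

section Family

variable (ζ : 𝟭 X ≅ 𝔖.log)

/-- A lax universal homotopy over an invertible 2-cell is invertible (inverse: the lax universal
homotopy over the inverse 2-cell). [cite: MochizukiAbsTopIII2015, Definition 3.5 (ii) p.75] -/
theorem luniv_isIso {V' : Type*} [Quiver V'] {D : DiagramOfCategories V'} (S : D.PseudoShadow)
    {a b : V'} (hb : (S.aug b).FullyFaithful) (p q : Path a b) (σ : S.shP p ⟶ S.shP q) [IsIso σ] :
    IsIso (S.luniv hb p q σ) :=
  ⟨⟨S.luniv hb q p (inv σ), by rw [← S.luniv_comp, IsIso.hom_inv_id, S.luniv_id],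
    by rw [← S.luniv_comp, IsIso.inv_hom_id, S.luniv_id]⟩⟩

/-- **The family of homotopies on `𝒟†_{≤3}` determined by `ζ : 𝟭 ≅ log`** (abc-iut-f-074's
`laxFamily` of the coherent system `kerCells ζ` on the shadow `kerShadow ζ`).
[cite: MochizukiAbsTopIII2015, Cor 3.7 (iv) p.88] -/
noncomputable def kerFamily : 𝔖.logObsDiagram.HomotopyFamily :=
  (𝔖.kerShadow ζ).laxFamily (𝔖.kerCells ζ) (𝔖.kerFF ζ)

/-- The boundary set of `kerFamily ζ` is "carries a cell". [cite: MochizukiAbsTopIII2015, Cor 3.7 (iv) p.88] -/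
theorem kerFamily_E {a b : logObsShape.{u}.Vertex} (p q : Path a b) :
    (𝔖.kerFamily ζ).E p q ↔ ∃ τ, 𝔖.KerCell ζ p q τ :=
  Iff.rfl

/-! ### The would-be core pairs `([pr_{⋎+1}], [pr_⋎]∘[log_𝒳])` carry ISOMORPHISMS -/

/-- The would-be core pair at `⋎ = n` carries the identity cell (equal shadows `𝟭_𝒳`, no
`λ^{×pf}`-edge). [cite: MochizukiAbsTopIII2015, Cor 3.7 (iv) p.88] -/
theorem kerCell_core (n : ℤ) :
    𝔖.KerCell ζ (corePathPr n) (corePathLog n)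
      (eqToHom (𝔖.kerShadow_shP_lvBox_eq ζ (corePathPr n) (corePathLog n))) :=
  .eq kerGood_lvBox _ (by
    rw [pfNum_eq_zero_of_ne_lvObs _ lvBox_ne_lvObs, pfNum_eq_zero_of_ne_lvObs _ lvBox_ne_lvObs])

/-- The would-be core pairs belong to the boundary set of `kerFamily ζ`.
[cite: MochizukiAbsTopIII2015, Cor 3.7 (iv) p.88] -/
theorem kerFamily_mem_core (n : ℤ) : (𝔖.kerFamily ζ).E (corePathPr n) (corePathLog n) :=
  ⟨_, 𝔖.kerCell_core ζ n⟩

/-- **`kerFamily ζ` contains an ISOMORPHISM `ζ₀` for every would-be core pair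
`([pr_{⋎+1}], [pr_⋎]∘[log_𝒳])`** (its homotopy is the lax universal homotopy over an identity 2-cell,
i.e. `ζ` whiskered by `pr_{⋎+1}` up to the structure isomorphisms).
[cite: MochizukiAbsTopIII2015, Cor 3.7 (iv) p.88] -/
theorem kerFamily_core (n : ℤ) :
    ∃ h₀ : (𝔖.kerFamily ζ).E (corePathPr n) (corePathLog n), IsIso ((𝔖.kerFamily ζ).η h₀) := by
  refine ⟨𝔖.kerFamily_mem_core ζ n, ?_⟩
  have hσ : (𝔖.kerCells ζ).σ (𝔖.kerFamily_mem_core ζ n) =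
      eqToHom (𝔖.kerShadow_shP_lvBox_eq ζ (corePathPr n) (corePathLog n)) :=
    kerσ_eq _ (𝔖.kerCell_core ζ n)
  haveI : IsIso ((𝔖.kerCells ζ).σ (𝔖.kerFamily_mem_core ζ n)) := by rw [hσ]; infer_instance
  haveI := luniv_isIso (𝔖.kerShadow ζ) (𝔖.kerFF ζ lvBox.{u} kerGood_lvBox) (corePathPr n)
    (corePathLog n) ((𝔖.kerCells ζ).σ (𝔖.kerFamily_mem_core ζ n))
  unfold kerFamily
  rw [PseudoShadow.laxFamily_η]
  infer_instance

/-! ### The pinned homotopies of `𝔖†_log` -/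

/-- The type-(2) pair `([λ^×], [λ^{×pf}])` carries the `ι_×` cell with empty prefixes.
[cite: MochizukiAbsTopIII2015, Cor 3.7 (iii) p.88] -/
theorem kerCell_times :
    𝔖.KerCell ζ timesPairLeft.{u} timesPairRight.{u}
      (eqToHom rfl ≫
        Functor.whiskerLeft ((𝔖.kerShadow ζ).shP (Path.nil : Path lvBox.{u} lvBox)) (𝔖.kerIota ζ)) :=
  .times Path.nil Path.nil rfl

/-- The type-(2) pair belongs to the boundary set. [cite: MochizukiAbsTopIII2015, Cor 3.7 (iii) p.88] -/
theorem kerFamily_mem_times : (𝔖.kerFamily ζ).E timesPairLeft.{u} timesPairRight.{u} :=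
  ⟨_, 𝔖.kerCell_times ζ⟩

/-- The left path of the type-(1) pair is `λ^×` behind the prefix `[pr_⋎]∘[log_𝒳]`.
[cite: MochizukiAbsTopIII2015, Cor 3.7 (iii) p.88] -/
theorem logPairLeft_eq (n : ℤ) : logPairLeft.{u} n = (corePathLog n).cons eLamTimes := rfl

/-- The right path of the type-(1) pair is `λ^{×pf}` behind the prefix `[pr_{⋎+1}]`.
[cite: MochizukiAbsTopIII2015, Cor 3.7 (iii) p.88] -/
theorem logPairRight_eq (n : ℤ) : logPairRight.{u} n = (corePathPr n).cons eLamPf := rfl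

/-- The shadows of `[λ^×]∘[pr_⋎]∘[log_𝒳]` and `[λ^×]∘[pr_{⋎+1}]` agree.
[cite: MochizukiAbsTopIII2015, Cor 3.7 (iii) p.88] -/
theorem kerShadow_shP_logPair (n : ℤ) :
    (𝔖.kerShadow ζ).shP ((corePathLog n).cons eLamTimes) =
      (𝔖.kerShadow ζ).shP ((corePathPr.{u} n).cons eLamTimes) := by
  rw [PseudoShadow.shP_cons, PseudoShadow.shP_cons,
    𝔖.kerShadow_shP_lvBox_eq ζ (corePathLog n) (corePathPr n)]

/-- The type-(1) pair at `⋎ = n` carries the `ι_×` cell with prefixes `[pr_⋎]∘[log_𝒳]`, `[pr_{⋎+1}]`.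
[cite: MochizukiAbsTopIII2015, Cor 3.7 (iii) p.88] -/
theorem kerCell_log (n : ℤ) :
    𝔖.KerCell ζ (logPairLeft.{u} n) (logPairRight.{u} n)
      (eqToHom (𝔖.kerShadow_shP_logPair ζ n) ≫
        Functor.whiskerLeft ((𝔖.kerShadow ζ).shP (corePathPr n)) (𝔖.kerIota ζ)) :=
  .times (corePathLog n) (corePathPr n) (𝔖.kerShadow_shP_logPair ζ n)

/-- The type-(1) pairs belong to the boundary set. [cite: MochizukiAbsTopIII2015, Cor 3.7 (iii) p.88] -/
theorem kerFamily_mem_log (n : ℤ) : (𝔖.kerFamily ζ).E (logPairLeft.{u} n) (logPairRight.{u} n) :=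
  ⟨_, 𝔖.kerCell_log ζ n⟩

/-- `𝟙 ≫ F(𝟙) = 𝟙` (applied by `exact`, across definitionally equal category instances). [folklore] -/
private theorem id_comp_map_id {C : Type*} [Category C] {D : Type*} [Category D] (F : C ⥤ D) (x : C) :
    𝟙 (F.obj x) ≫ F.map (𝟙 x) = 𝟙 (F.obj x) := by
  simp

/-- `F(𝟙) ≫ 𝟙 = 𝟙`. [folklore] -/
private theorem map_id_comp_id {C : Type*} [Category C] {D : Type*} [Category D] (F : C ⥤ D)
    (x : C) : F.map (𝟙 x) ≫ 𝟙 (F.obj x) = 𝟙 (F.obj x) := by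
  simp

/-- `F(𝟙 ≫ 𝟙) ≫ 𝟙 = 𝟙`. [folklore] -/
private theorem map_id_id_comp_id {C : Type*} [Category C] {D : Type*} [Category D] (F : C ⥤ D)
    (x : C) : F.map (𝟙 x ≫ 𝟙 x) ≫ 𝟙 (F.obj x) = 𝟙 (F.obj x) := by
  simp

/-- `𝟙 ≫ F(𝟙 ≫ f ≫ 𝟙) = F(f)`. [folklore] -/
private theorem id_comp_map_conj_id {C : Type*} [Category C] {D : Type*} [Category D] (F : C ⥤ D)
    {a b : C} (f : a ⟶ b) : 𝟙 (F.obj a) ≫ F.map (𝟙 a ≫ f ≫ 𝟙 b) = F.map f := by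
  simp

/-- `can_[λ^×]` is the identity. [cite: MochizukiAbsTopIII2015, Cor 3.7 (iii) p.88] -/
theorem kerShadow_canH_timesPairLeft (x : X) :
    (𝔖.kerShadow ζ).canH timesPairLeft.{u} x = 𝟙 (𝔖.lamTimes.obj x) := by
  show (𝔖.kerShadow ζ).canE eLamTimes.{u} x ≫ 𝔖.lamTimes.map (𝟙 x) = 𝟙 _
  rw [kerShadow_canE_eLamTimes]
  exact id_comp_map_id 𝔖.lamTimes x

/-- `can_[λ^{×pf}]⁻¹` is the identity. [cite: MochizukiAbsTopIII2015, Cor 3.7 (iii) p.88] -/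
theorem kerShadow_canI_timesPairRight (x : X) :
    (𝔖.kerShadow ζ).canI timesPairRight.{u} x = 𝟙 (𝔖.lamTimesPf.obj x) := by
  show 𝔖.lamTimesPf.map (𝟙 x) ≫ (𝔖.kerShadow ζ).canEI eLamPf.{u} x = 𝟙 _
  rw [kerShadow_canEI_eLamPf]
  exact map_id_comp_id 𝔖.lamTimesPf x

/-- `can_[λ^× ∘ pr_⋎ ∘ log_𝒳]` at `o` is `λ^×(ζ⁻¹)` at the first component of `o`.
[cite: MochizukiAbsTopIII2015, Cor 3.7 (iii) p.88] -/
theorem kerShadow_canH_logPairLeft (n : ℤ) (o : 𝔖.Sq) :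
    (𝔖.kerShadow ζ).canH (logPairLeft.{u} n) o = 𝔖.lamTimes.map (ζ.inv.app o.fst) := by
  show (𝔖.kerShadow ζ).canE eLamTimes.{u} (𝔖.log.obj o.fst) ≫
    𝔖.lamTimes.map ((𝔖.kerShadow ζ).canE (ePr n) (𝔖.logSq.obj o) ≫
      (𝟭 X).map ((𝔖.kerShadow ζ).canE (eLog n) o ≫ (𝟭 X).map (𝟙 o.fst))) = _
  rw [kerShadow_canE_eLamTimes, kerShadow_canE_ePr, kerShadow_canE_eLog, Functor.id_map,
    Functor.id_map]
  exact id_comp_map_conj_id 𝔖.lamTimes (ζ.inv.app o.fst)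

/-- `can_[λ^{×pf} ∘ pr_{⋎+1}]⁻¹` is the identity. [cite: MochizukiAbsTopIII2015, Cor 3.7 (iii) p.88] -/
theorem kerShadow_canI_logPairRight (n : ℤ) (o : 𝔖.Sq) :
    (𝔖.kerShadow ζ).canI (logPairRight.{u} n) o = 𝟙 (𝔖.lamTimesPf.obj o.fst) := by
  show 𝔖.lamTimesPf.map ((𝟭 X).map (𝟙 o.fst) ≫ (𝔖.kerShadow ζ).canEI (ePr (n + 1)) o) ≫
    (𝔖.kerShadow ζ).canEI eLamPf.{u} o.fst = 𝟙 _
  rw [kerShadow_canEI_eLamPf, kerShadow_canEI_ePr, Functor.id_map]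
  exact map_id_id_comp_id 𝔖.lamTimesPf o.fst

/-- `eqToHom` bookkeeping for the pinned type-(2) homotopy. [folklore] -/
private theorem pinned_times_aux {C : Type*} [Category C] {A P Q B : C} {f : A ⟶ B} {g : P ⟶ Q}
    (a : A = P) (b : Q = B) (a' : A = P) (b' : Q = B)
    (M : f = eqToHom a ≫ 𝟙 _ ≫ (𝟙 _ ≫ g) ≫ 𝟙 _ ≫ eqToHom b) : f = eqToHom a' ≫ g ≫ eqToHom b' := by
  subst a b
  simpa using M

/-- **The type-(2) pair carries `ι_×`** in `kerFamily ζ`. [cite: MochizukiAbsTopIII2015, Cor 3.7 (iii) p.88] -/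
theorem kerFamily_η_times (x : X)
    (e₁ : (𝔖.logObsDiagram.pathFunctor timesPairLeft.{u}).obj x = 𝔖.lamTimes.obj x)
    (e₂ : (𝔖.logObsDiagram.pathFunctor timesPairRight.{u}).obj x = 𝔖.lamTimesPf.obj x) :
    ((𝔖.kerFamily ζ).η (𝔖.kerFamily_mem_times ζ)).app x =
      eqToHom e₁ ≫ 𝔖.iotaTimes.app x ≫ eqToHom e₂.symm := by
  have M := (𝔖.kerShadow ζ).map_laxFamily_η_app (𝔖.kerCells ζ) (𝔖.kerFF ζ)
    (𝔖.kerFamily_mem_times ζ) x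
  have hσ : ((𝔖.kerCells ζ).σ (𝔖.kerFamily_mem_times ζ)).app
        (((𝔖.kerShadow ζ).aug lvBox.{u}).obj x) = 𝟙 _ ≫ 𝔖.iotaTimes.app x := by
    change (kerσ (𝔖.kerFamily_mem_times ζ)).app x = _
    rw [kerσ_eq _ (𝔖.kerCell_times ζ)]
    rfl
  rw [hσ, kerShadow_canH_timesPairLeft, kerShadow_canI_timesPairRight] at M
  exact pinned_times_aux _ _ e₁ e₂.symm M

/-- `eqToHom` bookkeeping for the pinned type-(1) homotopy. [folklore] -/
private theorem pinned_log_aux {C : Type*} [Category C] {A P Q R B : C} {f : A ⟶ B} (m : P ⟶ Q)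
    (g : Q ⟶ R) (l : P ⟶ R) (hl : m ≫ g = l) (a : A = P) (b : R = B) (a' : A = P) (b' : R = B)
    (M : f = eqToHom a ≫ m ≫ (𝟙 _ ≫ g) ≫ 𝟙 _ ≫ eqToHom b) : f = eqToHom a' ≫ l ≫ eqToHom b' := by
  subst a b hl
  simpa using M

/-- **The type-(1) pairs carry `ι_{log,⋎}`** in `kerFamily ζ`, PROVIDED `ζ` satisfies the kernel
equation `λ^×(ζ_A) ≫ ι_{log,A} = ι_{×,A}` (the cell gives `λ^×(ζ⁻¹) ≫ ι_×`, which is then `ι_log`).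
[cite: MochizukiAbsTopIII2015, Cor 3.7 (iii) p.88] -/
theorem kerFamily_η_log
    (hζ : ∀ A : X, 𝔖.lamTimes.map (ζ.hom.app A) ≫ 𝔖.iotaLog.app A = 𝔖.iotaTimes.app A)
    (n : ℤ) (o : 𝔖.Sq)
    (e₁ : (𝔖.logObsDiagram.pathFunctor (logPairLeft.{u} n)).obj o =
      𝔖.lamTimes.obj (𝔖.log.obj o.fst))
    (e₂ : (𝔖.logObsDiagram.pathFunctor (logPairRight.{u} n)).obj o = 𝔖.lamTimesPf.obj o.fst) :
    ((𝔖.kerFamily ζ).η (𝔖.kerFamily_mem_log ζ n)).app o =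
      eqToHom e₁ ≫ 𝔖.iotaLog.app o.fst ≫ eqToHom e₂.symm := by
  have M := (𝔖.kerShadow ζ).map_laxFamily_η_app (𝔖.kerCells ζ) (𝔖.kerFF ζ)
    (𝔖.kerFamily_mem_log ζ n) o
  have hσ : ((𝔖.kerCells ζ).σ (𝔖.kerFamily_mem_log ζ n)).app
        (((𝔖.kerShadow ζ).aug (lvFirst.{u} (n + 1))).obj o) = 𝟙 _ ≫ 𝔖.iotaTimes.app o.fst := by
    change (kerσ (𝔖.kerFamily_mem_log ζ n)).app o.fst = _
    rw [kerσ_eq _ (𝔖.kerCell_log ζ n)]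
    rfl
  rw [hσ, kerShadow_canH_logPairLeft, kerShadow_canI_logPairRight] at M
  have hl : 𝔖.lamTimes.map (ζ.inv.app o.fst) ≫ 𝔖.iotaTimes.app o.fst = 𝔖.iotaLog.app o.fst := by
    rw [← hζ, ← 𝔖.lamTimes.map_comp_assoc, Iso.inv_hom_id_app, Functor.map_id, Category.id_comp]
  exact pinned_log_aux _ _ _ hl _ _ e₁ e₂.symm M

/-- **`kerFamily ζ` is `LogPinned`** when `ζ` satisfies the kernel equation: it contains the type-(2)
pair `([λ^×],[λ^{×pf}])` with homotopy `ι_×` and, for every `⋎`, the type-(1) pair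
`([λ^×]∘[pr_⋎]∘[log_𝒳], [λ^{×pf}]∘[pr_{⋎+1}])` with homotopy `ι_{log,⋎}`.
[cite: MochizukiAbsTopIII2015, Cor 3.7 (iii) p.88] -/
theorem kerFamily_logPinned
    (hζ : ∀ A : X, 𝔖.lamTimes.map (ζ.hom.app A) ≫ 𝔖.iotaLog.app A = 𝔖.iotaTimes.app A) :
    Literature.AnabelianGeometry.AbsoluteAnabelian.AbsTopIII.BiAnabelianSetting.LogPinned 𝔖
      (𝔖.kerFamily ζ) :=
  ⟨⟨𝔖.kerFamily_mem_times ζ, fun x e₁ e₂ => 𝔖.kerFamily_η_times ζ x e₁ e₂⟩,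
    fun n => ⟨𝔖.kerFamily_mem_log ζ n, fun o e₁ e₂ => 𝔖.kerFamily_η_log ζ hζ n o e₁ e₂⟩⟩

end Family

/-! ## Cor 3.7 (iv), first incompatibility: the kernel statement is SUFFICIENT for its failure -/

/-- **A setting satisfying the kernel statement admits a structure of core on `𝒟†_{≤1}` compatible
with `𝔖†_log` (as typed)**: from `ζ : 𝟭 ⥲ log` with `λ^×(ζ) ≫ ι_log = ι_×` (`LogCoreKernel`,
F-0388), the family `kerFamily ζ` on `𝒟†_{≤3}` contains isomorphisms for all would-be core pairs
AND the pinned `𝔖†_log` homotopies — so `IncompatibleStmt 𝔖` (F-0319) FAILS.  With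
`incompatibleStmt_of_not_logCoreKernel` (sibling file) this is the exact criterion
`IncompatibleStmt 𝔖 ↔ ¬ LogCoreKernel 𝔖`. [cite: MochizukiAbsTopIII2015, Cor 3.7 (iv) p.88] -/
theorem not_incompatibleStmt_of_logCoreKernel
    (h : Literature.AnabelianGeometry.AbsoluteAnabelian.AbsTopIII.BiAnabelianSetting.LogCoreKernel 𝔖) :
    ¬ Literature.AnabelianGeometry.AbsoluteAnabelian.AbsTopIII.BiAnabelianSetting.IncompatibleStmt 𝔖 := by
  obtain ⟨ζ, hζ⟩ := h
  exact fun hI => hI ⟨𝔖.kerFamily ζ, 𝔖.kerFamily_core ζ, 𝔖.kerFamily_logPinned ζ hζ⟩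

/-- Equivalently: the typed first incompatibility of Cor 3.7 (iv) IMPLIES the negation of the kernel
statement. [cite: MochizukiAbsTopIII2015, Cor 3.7 (iv) p.88] -/
theorem not_logCoreKernel_of_incompatibleStmt
    (h : Literature.AnabelianGeometry.AbsoluteAnabelian.AbsTopIII.BiAnabelianSetting.IncompatibleStmt 𝔖) :
    ¬ Literature.AnabelianGeometry.AbsoluteAnabelian.AbsTopIII.BiAnabelianSetting.LogCoreKernel 𝔖 :=
  fun hk => 𝔖.not_incompatibleStmt_of_logCoreKernel hk h


end BiAnabelianSetting

end Literature.AnabelianGeometry.AbsoluteAnabelian.AbsTopIII
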